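import Mathlib.Analysis.Calculus.ContDiff.Bounds
import Mathlib.Analysis.Calculus.IteratedDeriv.Defs
import Mathlib.Analysis.Calculus.MeanValue

/-!
# Route EIHFluxBalance — `ModulatedKerrHandoff`, stub `stub_oneHoleMatching`: pointwise `Cᵏ` size calculus

Helper file for the crux `stmt-FinalStateConjecture-10167`
(`Summit.FinalStateConjecture.FinalStateConjecture.Theses.EIHFluxBalance.ModulatedKerrHandoff`),
line `photon-rocket-modulation`, stub `stub_oneHoleMatching` (one-hole profile matching).

The one-hole matching compares two composite fields `x ↦ 𝔉(p₁(x))` and `x ↦ 𝔉(p₀(x))` on `E4`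
(retarded versus instantaneous moduli fed into the same boosted Kerr–Schild kernel `𝔉`) in `C³`.
Every step of that comparison is a CRUDE bound on iterated derivatives of sums, products
(bounded bilinear pairings) and compositions at a point. This file packages Mathlib's Leibniz and
Faà di Bruno bounds (`ContinuousLinearMap.norm_iteratedFDerivWithin_le_of_bilinear`,
`norm_iteratedFDerivWithin_comp_le`) into lemmas about the two POINTWISE SIZE STATEMENTS

* `ContDiffAt ℝ n f x ∧ ∀ i ≤ n, ‖iteratedFDeriv ℝ i f x‖ ≤ C` ("`Cⁿ` size `≤ C` at `x`"),
* `ContDiffAt ℝ n f x ∧ ∀ i, 1 ≤ i → i ≤ n → ‖iteratedFDeriv ℝ i f x‖ ≤ C` (orders `1 … n` only —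
  the size of `f x` itself is irrelevant for inner functions of a composition, and is often large,
  e.g. for `x ↦ x`),

kept as plain conjunctions (no new predicates), closed under elementary operations with EXPLICIT
output constants (so that uniformity of the constants over families of base points is visible).
This file: monotonicity, change of function near the point, open neighbourhoods of smoothness,
constants, continuous linear maps, the identity, sums, differences, constant multiples,
post-composition with a continuous linear map, pairs, and the conversion from `iteratedDeriv`
bounds for functions of one real variable. The Leibniz and Faà di Bruno bounds are in the
continuation `…OneHoleLeibniz`. All statements are over `ℝ`. Dieudonné, *Foundations of modern
analysis* (1960), (8.12). [folklore]
-/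

noncomputable section

-- `Summit.<S>.<S>.…` (single-problem summit, D-0017) trips core's duplicate-namespace linter.
set_option linter.dupNamespace false

open Set Filter Function
open scoped Topology ContDiff

namespace Summit.FinalStateConjecture.FinalStateConjecture.Theorems

namespace OneHole

variable {E F G H : Type*} [NormedAddCommGroup E] [NormedSpace ℝ E] [NormedAddCommGroup F]
  [NormedSpace ℝ F] [NormedAddCommGroup G] [NormedSpace ℝ G] [NormedAddCommGroup H]
  [NormedSpace ℝ H]

/-! ### Basic manipulations -/

/-- A size constant bounding `‖D⁰f(x)‖ = ‖f x‖` is nonnegative. [folklore] -/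
theorem ck_nonneg {n : ℕ} {f : E → F} {x : E} {C : ℝ}
    (h : ContDiffAt ℝ n f x ∧ ∀ i ≤ n, ‖iteratedFDeriv ℝ i f x‖ ≤ C) : 0 ≤ C :=
  (norm_nonneg _).trans (h.2 0 (Nat.zero_le n))

/-- Weakening the constant and lowering the order. [folklore] -/
theorem ck_mono {m n : ℕ} {f : E → F} {x : E} {C C' : ℝ}
    (h : ContDiffAt ℝ n f x ∧ ∀ i ≤ n, ‖iteratedFDeriv ℝ i f x‖ ≤ C) (hm : m ≤ n) (hC : C ≤ C') :
    ContDiffAt ℝ m f x ∧ ∀ i ≤ m, ‖iteratedFDeriv ℝ i f x‖ ≤ C' :=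
  ⟨h.1.of_le (by exact_mod_cast hm), fun i hi ↦ (h.2 i (hi.trans hm)).trans hC⟩

/-- Weakening the constant and lowering the order (positive orders). [folklore] -/
theorem ck₁_mono {m n : ℕ} {f : E → F} {x : E} {C C' : ℝ}
    (h : ContDiffAt ℝ n f x ∧ ∀ i, 1 ≤ i → i ≤ n → ‖iteratedFDeriv ℝ i f x‖ ≤ C) (hm : m ≤ n)
    (hC : C ≤ C') :
    ContDiffAt ℝ m f x ∧ ∀ i, 1 ≤ i → i ≤ m → ‖iteratedFDeriv ℝ i f x‖ ≤ C' :=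
  ⟨h.1.of_le (by exact_mod_cast hm), fun i hi1 hi ↦ (h.2 i hi1 (hi.trans hm)).trans hC⟩

/-- Forgetting the order-zero bound. [folklore] -/
theorem ck₁_of_ck {n : ℕ} {f : E → F} {x : E} {C : ℝ}
    (h : ContDiffAt ℝ n f x ∧ ∀ i ≤ n, ‖iteratedFDeriv ℝ i f x‖ ≤ C) :
    ContDiffAt ℝ n f x ∧ ∀ i, 1 ≤ i → i ≤ n → ‖iteratedFDeriv ℝ i f x‖ ≤ C :=
  ⟨h.1, fun i _ hi ↦ h.2 i hi⟩

/-- Adding an order-zero bound. [folklore] -/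
theorem ck_of_ck₁ {n : ℕ} {f : E → F} {x : E} {C C₀ : ℝ}
    (h : ContDiffAt ℝ n f x ∧ ∀ i, 1 ≤ i → i ≤ n → ‖iteratedFDeriv ℝ i f x‖ ≤ C) (h0 : ‖f x‖ ≤ C₀) :
    ContDiffAt ℝ n f x ∧ ∀ i ≤ n, ‖iteratedFDeriv ℝ i f x‖ ≤ max C₀ C := by
  refine ⟨h.1, fun i hi ↦ ?_⟩
  rcases Nat.eq_zero_or_pos i with rfl | hi1
  · rw [norm_iteratedFDeriv_zero]
    exact h0.trans (le_max_left _ _)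
  · exact (h.2 i hi1 hi).trans (le_max_right _ _)

/-- The size statement is invariant under change of the function near the point. [folklore] -/
theorem ck_congr {n : ℕ} {f g : E → F} {x : E} {C : ℝ}
    (h : ContDiffAt ℝ n f x ∧ ∀ i ≤ n, ‖iteratedFDeriv ℝ i f x‖ ≤ C) (hfg : f =ᶠ[𝓝 x] g) :
    ContDiffAt ℝ n g x ∧ ∀ i ≤ n, ‖iteratedFDeriv ℝ i g x‖ ≤ C :=
  ⟨h.1.congr_of_eventuallyEq hfg.symm, fun i hi ↦ by
    rw [← (hfg.iteratedFDeriv ℝ i).eq_of_nhds]; exact h.2 i hi⟩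

/-- The positive-order size statement is invariant under change of the function near the point.
[folklore] -/
theorem ck₁_congr {n : ℕ} {f g : E → F} {x : E} {C : ℝ}
    (h : ContDiffAt ℝ n f x ∧ ∀ i, 1 ≤ i → i ≤ n → ‖iteratedFDeriv ℝ i f x‖ ≤ C) (hfg : f =ᶠ[𝓝 x] g) :
    ContDiffAt ℝ n g x ∧ ∀ i, 1 ≤ i → i ≤ n → ‖iteratedFDeriv ℝ i g x‖ ≤ C :=
  ⟨h.1.congr_of_eventuallyEq hfg.symm, fun i hi1 hi ↦ by
    rw [← (hfg.iteratedFDeriv ℝ i).eq_of_nhds]; exact h.2 i hi1 hi⟩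

/-- A `Cⁿ` function (at a point, `n : ℕ`) is `Cⁿ` on an open neighbourhood. [folklore] -/
theorem exists_isOpen_contDiffOn {n : ℕ} {f : E → F} {x : E} (h : ContDiffAt ℝ n f x) :
    ∃ u : Set E, IsOpen u ∧ x ∈ u ∧ ContDiffOn ℝ n f u := by
  obtain ⟨u, hu, hf⟩ := h.contDiffOn le_rfl (by simp)
  obtain ⟨v, hvu, hv, hxv⟩ := mem_nhds_iff.1 hu
  exact ⟨v, hv, hxv, hf.mono hvu⟩

/-- Two `Cⁿ` functions at a point are `Cⁿ` on a common open neighbourhood. [folklore] -/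
theorem exists_isOpen_contDiffOn₂ {n : ℕ} {f : E → F} {g : E → G} {x : E}
    (hf : ContDiffAt ℝ n f x) (hg : ContDiffAt ℝ n g x) :
    ∃ u : Set E, IsOpen u ∧ x ∈ u ∧ ContDiffOn ℝ n f u ∧ ContDiffOn ℝ n g u := by
  obtain ⟨u, hu, hxu, hfu⟩ := exists_isOpen_contDiffOn hf
  obtain ⟨v, hv, hxv, hgv⟩ := exists_isOpen_contDiffOn hg
  exact ⟨u ∩ v, hu.inter hv, ⟨hxu, hxv⟩, hfu.mono inter_subset_left, hgv.mono inter_subset_right⟩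

/-! ### Constants, linear maps, the identity -/

/-- A constant has all derivatives of positive order zero. [folklore] -/
theorem norm_iteratedFDeriv_const_of_pos (c : F) (x : E) {i : ℕ} (hi : 1 ≤ i) :
    ‖iteratedFDeriv ℝ i (fun _ : E ↦ c) x‖ = 0 := by
  rw [iteratedFDeriv_const_of_ne (by omega) c]
  simp

/-- Size of a constant. [folklore] -/
theorem ck_const (n : ℕ) (c : F) (x : E) :
    ContDiffAt ℝ n (fun _ : E ↦ c) x ∧ ∀ i ≤ n, ‖iteratedFDeriv ℝ i (fun _ : E ↦ c) x‖ ≤ ‖c‖ := by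
  refine ⟨contDiffAt_const, fun i hi ↦ ?_⟩
  rcases Nat.eq_zero_or_pos i with rfl | hi1
  · simp
  · rw [norm_iteratedFDeriv_const_of_pos c x hi1]
    exact norm_nonneg _

/-- Positive-order size of a constant (`0`). [folklore] -/
theorem ck₁_const (n : ℕ) (c : F) (x : E) :
    ContDiffAt ℝ n (fun _ : E ↦ c) x ∧
      ∀ i, 1 ≤ i → i ≤ n → ‖iteratedFDeriv ℝ i (fun _ : E ↦ c) x‖ ≤ 0 :=
  ⟨contDiffAt_const, fun _ hi1 _ ↦ (norm_iteratedFDeriv_const_of_pos c x hi1).le⟩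

/-- Derivatives of positive order of a continuous linear map have norm `≤ ‖L‖` (`D¹L = L`,
`DⁱL = 0` for `i ≥ 2`). [folklore] -/
theorem norm_iteratedFDeriv_clm_of_pos (L : E →L[ℝ] F) (x : E) {i : ℕ} (hi : 1 ≤ i) :
    ‖iteratedFDeriv ℝ i L x‖ ≤ ‖L‖ := by
  obtain ⟨k, rfl⟩ := Nat.exists_eq_add_of_le' hi
  rw [← norm_iteratedFDeriv_fderiv]
  have hfd : (fderiv ℝ (L : E → F)) = fun _ ↦ L := by
    funext y
    exact L.fderiv
  rw [hfd]
  rcases Nat.eq_zero_or_pos k with rfl | hk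
  · rw [norm_iteratedFDeriv_zero]
  · rw [iteratedFDeriv_const_of_ne (by omega) L]
    simp

/-- Positive-order size of a continuous linear map. [folklore] -/
theorem ck₁_clm (n : ℕ) (L : E →L[ℝ] F) (x : E) :
    ContDiffAt ℝ n L x ∧ ∀ i, 1 ≤ i → i ≤ n → ‖iteratedFDeriv ℝ i L x‖ ≤ ‖L‖ :=
  ⟨L.contDiff.contDiffAt, fun _ hi1 _ ↦ norm_iteratedFDeriv_clm_of_pos L x hi1⟩

/-- Size of a continuous linear map. [folklore] -/
theorem ck_clm (n : ℕ) (L : E →L[ℝ] F) (x : E) :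
    ContDiffAt ℝ n L x ∧ ∀ i ≤ n, ‖iteratedFDeriv ℝ i L x‖ ≤ max ‖L x‖ ‖L‖ :=
  ck_of_ck₁ (ck₁_clm n L x) le_rfl

/-- Positive-order size of the identity (`1`). [folklore] -/
theorem ck₁_id (n : ℕ) (x : E) :
    ContDiffAt ℝ n (fun y : E ↦ y) x ∧
      ∀ i, 1 ≤ i → i ≤ n → ‖iteratedFDeriv ℝ i (fun y : E ↦ y) x‖ ≤ 1 :=
  ck₁_mono (ck₁_clm n (ContinuousLinearMap.id ℝ E) x) le_rfl ContinuousLinearMap.norm_id_le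

/-- Size of the identity. [folklore] -/
theorem ck_id (n : ℕ) (x : E) :
    ContDiffAt ℝ n (fun y : E ↦ y) x ∧
      ∀ i ≤ n, ‖iteratedFDeriv ℝ i (fun y : E ↦ y) x‖ ≤ max ‖x‖ 1 :=
  ck_of_ck₁ (ck₁_id n x) le_rfl

/-! ### Sums and constant multiples -/

/-- Size of a sum. [folklore] -/
theorem ck_add {n : ℕ} {f g : E → F} {x : E} {Cf Cg : ℝ}
    (hf : ContDiffAt ℝ n f x ∧ ∀ i ≤ n, ‖iteratedFDeriv ℝ i f x‖ ≤ Cf)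
    (hg : ContDiffAt ℝ n g x ∧ ∀ i ≤ n, ‖iteratedFDeriv ℝ i g x‖ ≤ Cg) :
    ContDiffAt ℝ n (fun y ↦ f y + g y) x ∧
      ∀ i ≤ n, ‖iteratedFDeriv ℝ i (fun y ↦ f y + g y) x‖ ≤ Cf + Cg := by
  refine ⟨hf.1.add hg.1, fun i hi ↦ ?_⟩
  have h := iteratedFDeriv_add_apply (hf.1.of_le (by exact_mod_cast hi))
    (hg.1.of_le (by exact_mod_cast hi))
  rw [show (fun y ↦ f y + g y) = f + g from rfl, h]
  exact (norm_add_le _ _).trans (add_le_add (hf.2 i hi) (hg.2 i hi))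

/-- Positive-order size of a sum. [folklore] -/
theorem ck₁_add {n : ℕ} {f g : E → F} {x : E} {Cf Cg : ℝ}
    (hf : ContDiffAt ℝ n f x ∧ ∀ i, 1 ≤ i → i ≤ n → ‖iteratedFDeriv ℝ i f x‖ ≤ Cf)
    (hg : ContDiffAt ℝ n g x ∧ ∀ i, 1 ≤ i → i ≤ n → ‖iteratedFDeriv ℝ i g x‖ ≤ Cg) :
    ContDiffAt ℝ n (fun y ↦ f y + g y) x ∧
      ∀ i, 1 ≤ i → i ≤ n → ‖iteratedFDeriv ℝ i (fun y ↦ f y + g y) x‖ ≤ Cf + Cg := by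
  refine ⟨hf.1.add hg.1, fun i hi1 hi ↦ ?_⟩
  have h := iteratedFDeriv_add_apply (hf.1.of_le (by exact_mod_cast hi))
    (hg.1.of_le (by exact_mod_cast hi))
  rw [show (fun y ↦ f y + g y) = f + g from rfl, h]
  exact (norm_add_le _ _).trans (add_le_add (hf.2 i hi1 hi) (hg.2 i hi1 hi))

/-- Size of a difference. [folklore] -/
theorem ck_sub {n : ℕ} {f g : E → F} {x : E} {Cf Cg : ℝ}
    (hf : ContDiffAt ℝ n f x ∧ ∀ i ≤ n, ‖iteratedFDeriv ℝ i f x‖ ≤ Cf)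
    (hg : ContDiffAt ℝ n g x ∧ ∀ i ≤ n, ‖iteratedFDeriv ℝ i g x‖ ≤ Cg) :
    ContDiffAt ℝ n (fun y ↦ f y - g y) x ∧
      ∀ i ≤ n, ‖iteratedFDeriv ℝ i (fun y ↦ f y - g y) x‖ ≤ Cf + Cg := by
  refine ⟨hf.1.sub hg.1, fun i hi ↦ ?_⟩
  have h := iteratedFDeriv_sub_apply (hf.1.of_le (by exact_mod_cast hi))
    (hg.1.of_le (by exact_mod_cast hi))
  rw [show (fun y ↦ f y - g y) = f - g from rfl, h]
  exact (norm_sub_le _ _).trans (add_le_add (hf.2 i hi) (hg.2 i hi))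

/-- Positive-order size of a difference. [folklore] -/
theorem ck₁_sub {n : ℕ} {f g : E → F} {x : E} {Cf Cg : ℝ}
    (hf : ContDiffAt ℝ n f x ∧ ∀ i, 1 ≤ i → i ≤ n → ‖iteratedFDeriv ℝ i f x‖ ≤ Cf)
    (hg : ContDiffAt ℝ n g x ∧ ∀ i, 1 ≤ i → i ≤ n → ‖iteratedFDeriv ℝ i g x‖ ≤ Cg) :
    ContDiffAt ℝ n (fun y ↦ f y - g y) x ∧
      ∀ i, 1 ≤ i → i ≤ n → ‖iteratedFDeriv ℝ i (fun y ↦ f y - g y) x‖ ≤ Cf + Cg := by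
  refine ⟨hf.1.sub hg.1, fun i hi1 hi ↦ ?_⟩
  have h := iteratedFDeriv_sub_apply (hf.1.of_le (by exact_mod_cast hi))
    (hg.1.of_le (by exact_mod_cast hi))
  rw [show (fun y ↦ f y - g y) = f - g from rfl, h]
  exact (norm_sub_le _ _).trans (add_le_add (hf.2 i hi1 hi) (hg.2 i hi1 hi))

/-- Size of a constant multiple. [folklore] -/
theorem ck_const_smul {n : ℕ} {f : E → F} {x : E} {C : ℝ}
    (hf : ContDiffAt ℝ n f x ∧ ∀ i ≤ n, ‖iteratedFDeriv ℝ i f x‖ ≤ C) (a : ℝ) :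
    ContDiffAt ℝ n (fun y ↦ a • f y) x ∧
      ∀ i ≤ n, ‖iteratedFDeriv ℝ i (fun y ↦ a • f y) x‖ ≤ |a| * C := by
  refine ⟨hf.1.const_smul a, fun i hi ↦ ?_⟩
  rw [iteratedFDeriv_const_smul_apply' (hf.1.of_le (by exact_mod_cast hi)), norm_smul,
    Real.norm_eq_abs]
  exact mul_le_mul_of_nonneg_left (hf.2 i hi) (abs_nonneg a)

/-- Positive-order size of a constant multiple. [folklore] -/
theorem ck₁_const_smul {n : ℕ} {f : E → F} {x : E} {C : ℝ}
    (hf : ContDiffAt ℝ n f x ∧ ∀ i, 1 ≤ i → i ≤ n → ‖iteratedFDeriv ℝ i f x‖ ≤ C) (a : ℝ) :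
    ContDiffAt ℝ n (fun y ↦ a • f y) x ∧
      ∀ i, 1 ≤ i → i ≤ n → ‖iteratedFDeriv ℝ i (fun y ↦ a • f y) x‖ ≤ |a| * C := by
  refine ⟨hf.1.const_smul a, fun i hi1 hi ↦ ?_⟩
  rw [iteratedFDeriv_const_smul_apply' (hf.1.of_le (by exact_mod_cast hi)), norm_smul,
    Real.norm_eq_abs]
  exact mul_le_mul_of_nonneg_left (hf.2 i hi1 hi) (abs_nonneg a)

/-! ### Continuous linear maps applied after; pairs -/

/-- Size after a continuous linear map. [folklore] -/
theorem ck_clm_comp_left {n : ℕ} {f : E → F} {x : E} {C : ℝ}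
    (hf : ContDiffAt ℝ n f x ∧ ∀ i ≤ n, ‖iteratedFDeriv ℝ i f x‖ ≤ C) (L : F →L[ℝ] G) :
    ContDiffAt ℝ n (fun y ↦ L (f y)) x ∧
      ∀ i ≤ n, ‖iteratedFDeriv ℝ i (fun y ↦ L (f y)) x‖ ≤ ‖L‖ * C :=
  ⟨(L.contDiff.of_le le_top).contDiffAt.comp x hf.1, fun i hi ↦
    (L.norm_iteratedFDeriv_comp_left hf.1 (by exact_mod_cast hi)).trans
      (mul_le_mul_of_nonneg_left (hf.2 i hi) (norm_nonneg L))⟩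

/-- Positive-order size after a continuous linear map. [folklore] -/
theorem ck₁_clm_comp_left {n : ℕ} {f : E → F} {x : E} {C : ℝ}
    (hf : ContDiffAt ℝ n f x ∧ ∀ i, 1 ≤ i → i ≤ n → ‖iteratedFDeriv ℝ i f x‖ ≤ C) (L : F →L[ℝ] G) :
    ContDiffAt ℝ n (fun y ↦ L (f y)) x ∧
      ∀ i, 1 ≤ i → i ≤ n → ‖iteratedFDeriv ℝ i (fun y ↦ L (f y)) x‖ ≤ ‖L‖ * C :=
  ⟨(L.contDiff.of_le le_top).contDiffAt.comp x hf.1, fun i hi1 hi ↦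
    (L.norm_iteratedFDeriv_comp_left hf.1 (by exact_mod_cast hi)).trans
      (mul_le_mul_of_nonneg_left (hf.2 i hi1 hi) (norm_nonneg L))⟩

/-- Size of a pair (the product norm is the max). [folklore] -/
theorem ck_prodMk {n : ℕ} {f : E → F} {g : E → G} {x : E} {Cf Cg : ℝ}
    (hf : ContDiffAt ℝ n f x ∧ ∀ i ≤ n, ‖iteratedFDeriv ℝ i f x‖ ≤ Cf)
    (hg : ContDiffAt ℝ n g x ∧ ∀ i ≤ n, ‖iteratedFDeriv ℝ i g x‖ ≤ Cg) :
    ContDiffAt ℝ n (fun y ↦ (f y, g y)) x ∧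
      ∀ i ≤ n, ‖iteratedFDeriv ℝ i (fun y ↦ (f y, g y)) x‖ ≤ max Cf Cg := by
  refine ⟨hf.1.prodMk hg.1, fun i hi ↦ ?_⟩
  rw [iteratedFDeriv_prodMk (hf.1.of_le (by exact_mod_cast hi)) (hg.1.of_le (by exact_mod_cast hi))
    le_rfl, ContinuousMultilinearMap.opNorm_prod]
  exact max_le_max (hf.2 i hi) (hg.2 i hi)

/-- Positive-order size of a pair. [folklore] -/
theorem ck₁_prodMk {n : ℕ} {f : E → F} {g : E → G} {x : E} {Cf Cg : ℝ}
    (hf : ContDiffAt ℝ n f x ∧ ∀ i, 1 ≤ i → i ≤ n → ‖iteratedFDeriv ℝ i f x‖ ≤ Cf)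
    (hg : ContDiffAt ℝ n g x ∧ ∀ i, 1 ≤ i → i ≤ n → ‖iteratedFDeriv ℝ i g x‖ ≤ Cg) :
    ContDiffAt ℝ n (fun y ↦ (f y, g y)) x ∧
      ∀ i, 1 ≤ i → i ≤ n → ‖iteratedFDeriv ℝ i (fun y ↦ (f y, g y)) x‖ ≤ max Cf Cg := by
  refine ⟨hf.1.prodMk hg.1, fun i hi1 hi ↦ ?_⟩
  rw [iteratedFDeriv_prodMk (hf.1.of_le (by exact_mod_cast hi)) (hg.1.of_le (by exact_mod_cast hi))
    le_rfl, ContinuousMultilinearMap.opNorm_prod]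
  exact max_le_max (hf.2 i hi1 hi) (hg.2 i hi1 hi)

/-! ### Real functions of one variable -/

/-- Size from bounds on `iteratedDeriv` (functions on `ℝ`). [folklore] -/
theorem ck_of_iteratedDeriv {n : ℕ} {f : ℝ → F} {t : ℝ} {C : ℝ} (hf : ContDiffAt ℝ n f t)
    (h : ∀ i ≤ n, ‖iteratedDeriv i f t‖ ≤ C) :
    ContDiffAt ℝ n f t ∧ ∀ i ≤ n, ‖iteratedFDeriv ℝ i f t‖ ≤ C :=
  ⟨hf, fun i hi ↦ by rw [norm_iteratedFDeriv_eq_norm_iteratedDeriv]; exact h i hi⟩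

/-- Positive-order size from bounds on `iteratedDeriv` (functions on `ℝ`). [folklore] -/
theorem ck₁_of_iteratedDeriv {n : ℕ} {f : ℝ → F} {t : ℝ} {C : ℝ} (hf : ContDiffAt ℝ n f t)
    (h : ∀ i, 1 ≤ i → i ≤ n → ‖iteratedDeriv i f t‖ ≤ C) :
    ContDiffAt ℝ n f t ∧ ∀ i, 1 ≤ i → i ≤ n → ‖iteratedFDeriv ℝ i f t‖ ≤ C :=
  ⟨hf, fun i hi1 hi ↦ by rw [norm_iteratedFDeriv_eq_norm_iteratedDeriv]; exact h i hi1 hi⟩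

end OneHole

/-- Registered sub-goal form (stub `oneHole_ck_prodMk` of the crux item) of `OneHole.ck_prodMk`:
the pointwise `Cⁿ` size of a pair is the max of the sizes. [folklore] -/
theorem oneHole_ck_prodMk : ∀ {E F G : Type*} [NormedAddCommGroup E] [NormedSpace ℝ E] [NormedAddCommGroup F] [NormedSpace ℝ F] [NormedAddCommGroup G] [NormedSpace ℝ G] {n : ℕ} {f : E → F} {g : E → G} {x : E} {Cf Cg : ℝ}, (ContDiffAt ℝ n f x ∧ ∀ i ≤ n, ‖iteratedFDeriv ℝ i f x‖ ≤ Cf) → (ContDiffAt ℝ n g x ∧ ∀ i ≤ n, ‖iteratedFDeriv ℝ i g x‖ ≤ Cg) → ContDiffAt ℝ n (fun y ↦ (f y, g y)) x ∧ ∀ i ≤ n, ‖iteratedFDeriv ℝ i (fun y ↦ (f y, g y)) x‖ ≤ max Cf Cg :=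
  fun hf hg ↦ OneHole.ck_prodMk hf hg

end Summit.FinalStateConjecture.FinalStateConjecture.Theorems

end
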